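import Summits.CriticalPhenomena.PercolationContinuityZ3.Theorems.PercNearOneGluingNoHeavyQuantSDEC
import HarnessLib

/-!
# QUANT lane: EVERY ROW AT MOST BOTH MEANS IS FREE — the sharp form of `…QuantTLBBelowTargets`: rows `d = k` of `gate (lconv μ₁ μ₂) q`
# with `k ≤ min(T₁, T₂)` (MEANS, not targets; non-strict) and `2k < q(T₁+T₂)` need no hypothesis on the factors; public region lemmas

builds on p205010 (kernel theorem, internal audit signed; external expert review pending)

Support file (`--supports stmt-CriticalPhenomena-4575`), QUANT lane seat prim-quant-arm-3 (gen 165); third of the series `…QuantTLBRowZero`,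
`…QuantTLBBalancedRows`, `…QuantTLBBelowTargets` (same two-level pure-tilt certificate).  Re-reading the proof shows it uses only
`k ≤ T₁`, `k ≤ T₂` (through `a ≤ k ⇒ a ≤ T₁` and `T₂ ≤ T₁ + T₂ − k`), the row's legality `2k < q(T₁+T₂)`, `y ≤ q ≤ 1` and top-affordability —
not `k < q·Tᵢ`.  Exact scan (memo §7): for `q < 1` the explicit certificate indeed works down to `k ≤ Tᵢ` and fails just below
(e.g. `y = 1/2`, `q = 19/20`, `t₁ = 6`, `k = 3`: valid iff `t₂ ≥ 23/8`, i.e. `T₂ = t₂/q ≥ 3`).  So the conjectured closure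
`TLBGateConvClosedHeavy` is open exactly on the rows `min(T₁,T₂) < k < q(T₁+T₂)/2`.
This file makes the six region inequalities PUBLIC (`tilt_LL_low`, `tilt_LL_mid`, `tilt_HH_mid`, `tilt_HH_tgt`, `tilt_LH_mid`, `tilt_LH_tgt`)
for reuse in further tilt certificates, proves the sharp cell inequality `belowMeans_cell`, and the row `gateConv_row_belowMeans`
(through a private copy of the pure-tilt principle `gateConv_row_of_tilts` of `…QuantTLBBelowTargets`, whose olean is not yet on the farm).

[this work]; the rows served belong to the gluing programme of [cite: KozmaNitzan2024, Conjecture 3 (p. 15)].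
-/

noncomputable section

namespace Summit.CriticalPhenomena.PercolationContinuityZ3.Theorems

namespace Quant

open Finset

namespace LawDec

/-! ### Bookkeeping (private; as in `…QuantTLBBalancedRows`) -/

/-- a test function against the convolution. [this work] -/
private theorem bm_sum_fun_mul_lconv (M₁ M₂ : ℕ) (μ₁ μ₂ : ℕ → ℝ) (φ : ℕ → ℝ) :
    ∑ h ∈ Finset.range (M₁ + M₂ + 1), φ h * lconv M₁ M₂ μ₁ μ₂ h
      = ∑ a ∈ Finset.range (M₁ + 1), ∑ s ∈ Finset.range (M₂ + 1), φ (a + s) * (μ₁ a * μ₂ s) := by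
  simp only [lconv, Finset.mul_sum]
  rw [Finset.sum_comm]
  refine Finset.sum_congr rfl fun a ha => ?_
  rw [Finset.sum_comm]
  refine Finset.sum_congr rfl fun s hs => ?_
  rw [Finset.mem_range] at ha hs
  have e : ∀ h : ℕ, φ h * (if a + s = h then μ₁ a * μ₂ s else 0) = if a + s = h then φ (a + s) * (μ₁ a * μ₂ s) else 0 := by
    intro h
    split_ifs with hh
    · rw [hh]
    · rw [mul_zero]
  simp_rw [e]
  rw [Finset.sum_ite_eq (Finset.range (M₁ + M₂ + 1)) (a + s), if_pos (Finset.mem_range.2 (by omega))]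

/-- a test function against a gated law. [this work] -/
private theorem bm_sum_fun_mul_gate (M : ℕ) (μ : ℕ → ℝ) (q : ℝ) (φ : ℕ → ℝ) :
    ∑ h ∈ Finset.range (M + 1), φ h * gate μ q h = q * ∑ h ∈ Finset.range (M + 1), φ h * μ h + (1 - q) * φ 0 := by
  simp only [gate]
  have e : ∀ h : ℕ, φ h * (q * μ h + (if h = 0 then 1 - q else 0)) = q * (φ h * μ h) + (if h = 0 then (1 - q) * φ 0 else 0) := by
    intro h
    split_ifs with hh
    · rw [hh]; ring
    · ring
  simp_rw [e]
  rw [Finset.sum_add_distrib, ← Finset.mul_sum, Finset.sum_ite_eq' (Finset.range (M + 1)) 0,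
    if_pos (Finset.mem_range.2 (Nat.succ_pos M))]

/-- the mean of a probability law on `{0..M}` is at most `M`. [this work] -/
private theorem bm_mean_le (M : ℕ) (μ : ℕ → ℝ) (hμ : ∀ h, 0 ≤ μ h) (hμ1 : ∑ h ∈ Finset.range (M + 1), μ h = 1) :
    ∑ h ∈ Finset.range (M + 1), (h : ℝ) * μ h ≤ M := by
  calc ∑ h ∈ Finset.range (M + 1), (h : ℝ) * μ h ≤ ∑ h ∈ Finset.range (M + 1), (M : ℝ) * μ h := by
        refine Finset.sum_le_sum fun h hh => ?_
        rw [Finset.mem_range] at hh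
        exact mul_le_mul_of_nonneg_right (by exact_mod_cast Nat.lt_succ_iff.mp hh) (hμ h)
    _ = M := by rw [← Finset.mul_sum, hμ1, mul_one]

/-! ### The six region inequalities of the two-level certificate (pure real arithmetic; PUBLIC for reuse) -/

/-- both indices `≤ k`, low cell (`n = a+s ≤ k`). [this work] -/
theorem tilt_LL_low {u T k n : ℝ} (hu : 0 ≤ u) (hTk : k < T) (hn : n ≤ k) :
    u / (T - k) * (n - T) ≤ -u := by
  have hD : 0 < T - k := by linarith
  rw [div_mul_eq_mul_div, div_le_iff₀ hD]
  nlinarith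

/-- both indices `≤ k`, middle cell (`k < n ≤ 2k`). [this work] -/
theorem tilt_LL_mid {u T k n q : ℝ} (hu : 0 ≤ u) (hk : 0 ≤ k) (hTk : k < T) (hq1 : q ≤ 1) (hn : n ≤ 2 * k) (h2k : 2 * k < q * T) :
    u / (T - k) * (n - T) ≤ -(u * (1 - q)) := by
  have hD : 0 < T - k := by linarith
  rw [div_mul_eq_mul_div, div_le_iff₀ hD]
  have h1 : n - T ≤ -((1 - q) * (T - k)) := by nlinarith
  nlinarith

/-- both indices `> k`, middle cell (`n < qT − k`). [this work] -/
theorem tilt_HH_mid {u T k n q : ℝ} (hu : 0 ≤ u) (hk : 0 ≤ k) (hT : 0 < T) (hn : n ≤ q * T - k) :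
    u / T * (n - T) ≤ -(u * (1 - q)) := by
  rw [div_mul_eq_mul_div, div_le_iff₀ hT]
  have h1 : n - T ≤ -((1 - q) * T) := by linarith
  nlinarith

/-- both indices `> k`, target cell: the top-affordability identity `B·(qT/y − T) = u(q−y)/y`. [this work] -/
theorem tilt_HH_tgt {y T n q : ℝ} (hy0 : 0 < y) (hy1 : y < 1) (hT : 0 < T) (hn : y * n ≤ q * T) :
    y / (1 - y) / T * (n - T) ≤ y / (1 - y) * (q - y) / y := by
  have h1y : 0 < 1 - y := by linarith
  have hu : 0 < y / (1 - y) := div_pos hy0 h1y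
  have key : (n - T) / T ≤ (q - y) / y := by
    rw [div_le_div_iff₀ hT hy0]
    nlinarith
  calc y / (1 - y) / T * (n - T) = y / (1 - y) * ((n - T) / T) := by ring
    _ ≤ y / (1 - y) * ((q - y) / y) := mul_le_mul_of_nonneg_left key hu.le
    _ = y / (1 - y) * (q - y) / y := by ring

/-- mixed region `a ≤ k < s`, middle cell (`a + s < qT − k`): after clearing denominators the slack is
`a k + k((1−q)T₁ + (2−q)T₂) ≥ 0`. [this work] -/
theorem tilt_LH_mid {u T₁ T₂ k a s q : ℝ} (hu : 0 ≤ u) (hk : 0 ≤ k) (ha : 0 ≤ a) (hT1 : 0 ≤ T₁) (hT2 : 0 ≤ T₂)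
    (hq1 : q ≤ 1) (hTk : k < T₁ + T₂) (hcell : a + s ≤ q * (T₁ + T₂) - k) :
    u / (T₁ + T₂) * (a - T₁) + u / (T₁ + T₂ - k) * (s - T₂) ≤ -(u * (1 - q)) := by
  have hT : 0 < T₁ + T₂ := by linarith
  have hD : 0 < T₁ + T₂ - k := by linarith
  -- the cleared inequality
  have hid : (a - T₁) * (T₁ + T₂ - k) + (q * (T₁ + T₂) - k - a - T₂) * (T₁ + T₂) + (1 - q) * (T₁ + T₂) * (T₁ + T₂ - k)
      = -(a * k) - k * ((1 - q) * T₁ + (2 - q) * T₂) := by ring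
  have hsT : (s - T₂) * (T₁ + T₂) ≤ (q * (T₁ + T₂) - k - a - T₂) * (T₁ + T₂) :=
    mul_le_mul_of_nonneg_right (by linarith) hT.le
  have hak : 0 ≤ a * k := mul_nonneg ha hk
  have hkk : 0 ≤ k * ((1 - q) * T₁ + (2 - q) * T₂) := mul_nonneg hk (by nlinarith)
  have hcl : (a - T₁) * (T₁ + T₂ - k) + (s - T₂) * (T₁ + T₂) + (1 - q) * (T₁ + T₂) * (T₁ + T₂ - k) ≤ 0 := by linarith
  rw [div_mul_eq_mul_div, div_mul_eq_mul_div, div_add_div _ _ hT.ne' hD.ne', div_le_iff₀ (mul_pos hT hD)]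
  have h3 : 0 ≤ u * -((a - T₁) * (T₁ + T₂ - k) + (s - T₂) * (T₁ + T₂) + (1 - q) * (T₁ + T₂) * (T₁ + T₂ - k)) :=
    mul_nonneg hu (by linarith)
  nlinarith

/-- mixed region `a ≤ k < s`, target cell: `B(a − T₁) ≤ 0` and `A(s − T₂) ≤ u(q−y)/y` (because `T₂ ≤ T − k`). [this work] -/
theorem tilt_LH_tgt {y T₁ T₂ k a s q : ℝ} (hy0 : 0 < y) (hy1 : y < 1) (hyq : y ≤ q) (hk : 0 ≤ k)
    (haT : a ≤ T₁) (hkT : k ≤ T₁) (hTk : k < T₁ + T₂) (hs : y * s ≤ q * T₂) :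
    y / (1 - y) / (T₁ + T₂) * (a - T₁) + y / (1 - y) / (T₁ + T₂ - k) * (s - T₂) ≤ y / (1 - y) * (q - y) / y := by
  have h1y : 0 < 1 - y := by linarith
  have hu : 0 < y / (1 - y) := div_pos hy0 h1y
  have hT : 0 < T₁ + T₂ := by linarith
  have hD : 0 < T₁ + T₂ - k := by linarith
  have h1 : y / (1 - y) / (T₁ + T₂) * (a - T₁) ≤ 0 := by
    have : y / (1 - y) / (T₁ + T₂) * (T₁ - a) ≥ 0 := mul_nonneg (div_pos hu hT).le (by linarith)
    linarith
  have h2 : (s - T₂) / (T₁ + T₂ - k) ≤ (q - y) / y := by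
    rw [div_le_div_iff₀ hD hy0]
    -- y (s - T₂) ≤ (q-y) T₂ ≤ (q - y)(T₁ + T₂ - k)
    have e1 : (s - T₂) * y ≤ (q - y) * T₂ := by nlinarith
    have e2 : (q - y) * T₂ ≤ (q - y) * (T₁ + T₂ - k) := mul_le_mul_of_nonneg_left (by linarith) (by linarith)
    linarith
  calc y / (1 - y) / (T₁ + T₂) * (a - T₁) + y / (1 - y) / (T₁ + T₂ - k) * (s - T₂)
      ≤ 0 + y / (1 - y) * ((s - T₂) / (T₁ + T₂ - k)) := by
        have : y / (1 - y) / (T₁ + T₂ - k) * (s - T₂) = y / (1 - y) * ((s - T₂) / (T₁ + T₂ - k)) := by ring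
        rw [this]; linarith
    _ ≤ 0 + y / (1 - y) * ((q - y) / y) := by
        have := mul_le_mul_of_nonneg_left h2 hu.le
        linarith
    _ = y / (1 - y) * (q - y) / y := by ring

/-! ### The certificate and the row -/

/-- (private copy of `LawDec.gateConv_row_of_tilts`, `…QuantTLBBelowTargets`) **the pure-tilt principle.**  `0 < y < 1`; probability laws `μ₁`, `μ₂` on `{0..M₁}`, `{0..M₂}` with means `T₁`, `T₂`;
a row index `k ≤ M₁ + M₂` with `k < q(T₁+T₂)`.  ANY functions `r₁ r₂ : ℕ → ℝ` ("mean tilts") with the pointwise inequality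
`r₁ s·(a − T₁) + r₂ a·(s − T₂) ≤ q·[q(T₁+T₂) − k ≤ a+s] − (y/(1−y)) q·[a+s ≤ k] − (y/(1−y))(1−q)` on `{0..M₁}×{0..M₂}` prove the
two-layer row `d = k` of `gate (lconv M₁ M₂ μ₁ μ₂) q` at threshold `q(T₁+T₂)` — no hypothesis on the factors. [this work] -/
private theorem bm_row_of_tilts {y q T₁ T₂ : ℝ} {M₁ M₂ k : ℕ} {μ₁ μ₂ : ℕ → ℝ} (r₁ r₂ : ℕ → ℝ)
    (hy0 : 0 < y) (hy1 : y < 1)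
    (h10 : ∀ h, 0 ≤ μ₁ h) (h11 : ∑ h ∈ Finset.range (M₁ + 1), μ₁ h = 1) (hT1 : ∑ h ∈ Finset.range (M₁ + 1), (h : ℝ) * μ₁ h = T₁)
    (h20 : ∀ h, 0 ≤ μ₂ h) (h21 : ∑ h ∈ Finset.range (M₂ + 1), μ₂ h = 1) (hT2 : ∑ h ∈ Finset.range (M₂ + 1), (h : ℝ) * μ₂ h = T₂)
    (hkM : k ≤ M₁ + M₂) (hkt : (k : ℝ) < q * (T₁ + T₂))
    (hcell : ∀ a s : ℕ, a ≤ M₁ → s ≤ M₂ →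
      r₁ s * ((a : ℝ) - T₁) + r₂ a * ((s : ℝ) - T₂)
        ≤ q * (if q * (T₁ + T₂) - k ≤ (a : ℝ) + s then 1 else 0) - y / (1 - y) * q * (if a + s ≤ k then 1 else 0)
            - y / (1 - y) * (1 - q)) :
    y / (1 - y) * ∑ h ∈ Finset.range (k + 1), gate (lconv M₁ M₂ μ₁ μ₂) q h
      ≤ ∑ h ∈ Finset.range (M₁ + M₂ + 1),
          (if q * (T₁ + T₂) - k ≤ (h : ℝ) then gate (lconv M₁ M₂ μ₁ μ₂) q h else 0) := by
  have h1y : 0 < 1 - y := by linarith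
  have hu : 0 < y / (1 - y) := div_pos hy0 h1y
  set ν := gate (lconv M₁ M₂ μ₁ μ₂) q with hν
  have hlow : ∑ h ∈ Finset.range (k + 1), ν h
      = ∑ h ∈ Finset.range (M₁ + M₂ + 1), (if h ≤ k then (1 : ℝ) else 0) * ν h := by
    rw [← Finset.sum_filter_add_sum_filter_not (Finset.range (M₁ + M₂ + 1)) (fun h => h ≤ k)]
    have hz : ∑ h ∈ Finset.filter (fun h => ¬ h ≤ k) (Finset.range (M₁ + M₂ + 1)), (if h ≤ k then (1 : ℝ) else 0) * ν h = 0 := by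
      refine Finset.sum_eq_zero fun h hh => ?_
      rw [Finset.mem_filter] at hh
      rw [if_neg hh.2, zero_mul]
    have hf : Finset.filter (fun h => h ≤ k) (Finset.range (M₁ + M₂ + 1)) = Finset.range (k + 1) := by
      ext h
      simp only [Finset.mem_filter, Finset.mem_range]
      omega
    rw [hz, add_zero, hf]
    refine Finset.sum_congr rfl fun h hh => ?_
    rw [Finset.mem_range] at hh
    rw [if_pos (by omega), one_mul]
  have hhigh : ∑ h ∈ Finset.range (M₁ + M₂ + 1), (if q * (T₁ + T₂) - k ≤ (h : ℝ) then ν h else 0)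
      = ∑ h ∈ Finset.range (M₁ + M₂ + 1), (if q * (T₁ + T₂) - k ≤ (h : ℝ) then (1 : ℝ) else 0) * ν h :=
    Finset.sum_congr rfl fun h _ => by split_ifs <;> simp
  rw [hlow, hhigh, hν, bm_sum_fun_mul_gate, bm_sum_fun_mul_gate, bm_sum_fun_mul_lconv, bm_sum_fun_mul_lconv]
  simp only [Nat.zero_le, if_true, Nat.cast_zero, mul_one]
  have hnt0 : ¬ (q * (T₁ + T₂) - k ≤ (0 : ℝ)) := by
    intro h; linarith
  rw [if_neg hnt0, mul_zero, add_zero]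
  have hmass : ∑ a ∈ Finset.range (M₁ + 1), ∑ s ∈ Finset.range (M₂ + 1), μ₁ a * μ₂ s = 1 := by
    rw [← Finset.sum_mul_sum, h11, h21, one_mul]
  have htilt1 : ∑ a ∈ Finset.range (M₁ + 1), ∑ s ∈ Finset.range (M₂ + 1), r₁ s * ((a : ℝ) - T₁) * (μ₁ a * μ₂ s) = 0 := by
    rw [Finset.sum_comm]
    refine Finset.sum_eq_zero fun s _ => ?_
    have e : ∀ a ∈ Finset.range (M₁ + 1),
        r₁ s * ((a : ℝ) - T₁) * (μ₁ a * μ₂ s) = (r₁ s * μ₂ s) * ((a : ℝ) * μ₁ a - T₁ * μ₁ a) := by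
      intro a _; ring
    rw [Finset.sum_congr rfl e, ← Finset.mul_sum, Finset.sum_sub_distrib, ← Finset.mul_sum, hT1, h11, mul_one, sub_self, mul_zero]
  have htilt2 : ∑ a ∈ Finset.range (M₁ + 1), ∑ s ∈ Finset.range (M₂ + 1), r₂ a * ((s : ℝ) - T₂) * (μ₁ a * μ₂ s) = 0 := by
    refine Finset.sum_eq_zero fun a _ => ?_
    have e : ∀ s ∈ Finset.range (M₂ + 1),
        r₂ a * ((s : ℝ) - T₂) * (μ₁ a * μ₂ s) = (r₂ a * μ₁ a) * ((s : ℝ) * μ₂ s - T₂ * μ₂ s) := by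
      intro s _; ring
    rw [Finset.sum_congr rfl e, ← Finset.mul_sum, Finset.sum_sub_distrib, ← Finset.mul_sum, hT2, h21, mul_one, sub_self, mul_zero]
  have hsum : ∑ a ∈ Finset.range (M₁ + 1), ∑ s ∈ Finset.range (M₂ + 1),
      (r₁ s * ((a : ℝ) - T₁) * (μ₁ a * μ₂ s) + r₂ a * ((s : ℝ) - T₂) * (μ₁ a * μ₂ s))
      ≤ ∑ a ∈ Finset.range (M₁ + 1), ∑ s ∈ Finset.range (M₂ + 1),
        (q * (if q * (T₁ + T₂) - k ≤ (a : ℝ) + s then (1 : ℝ) else 0) - y / (1 - y) * q * (if a + s ≤ k then (1 : ℝ) else 0)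
          - y / (1 - y) * (1 - q)) * (μ₁ a * μ₂ s) := by
    refine Finset.sum_le_sum fun a ha => Finset.sum_le_sum fun s hs => ?_
    rw [Finset.mem_range] at ha hs
    have hc := hcell a s (Nat.lt_succ_iff.mp ha) (Nat.lt_succ_iff.mp hs)
    have hw : 0 ≤ μ₁ a * μ₂ s := mul_nonneg (h10 a) (h20 s)
    nlinarith
  have hL : ∑ a ∈ Finset.range (M₁ + 1), ∑ s ∈ Finset.range (M₂ + 1),
      (r₁ s * ((a : ℝ) - T₁) * (μ₁ a * μ₂ s) + r₂ a * ((s : ℝ) - T₂) * (μ₁ a * μ₂ s)) = 0 := by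
    rw [Finset.sum_congr rfl fun a _ => Finset.sum_add_distrib, Finset.sum_add_distrib, htilt1, htilt2, add_zero]
  have hR : ∑ a ∈ Finset.range (M₁ + 1), ∑ s ∈ Finset.range (M₂ + 1),
      (q * (if q * (T₁ + T₂) - k ≤ (a : ℝ) + s then (1 : ℝ) else 0) - y / (1 - y) * q * (if a + s ≤ k then (1 : ℝ) else 0)
          - y / (1 - y) * (1 - q)) * (μ₁ a * μ₂ s)
      = q * ∑ a ∈ Finset.range (M₁ + 1), ∑ s ∈ Finset.range (M₂ + 1),
            (if q * (T₁ + T₂) - k ≤ ((a + s : ℕ) : ℝ) then (1 : ℝ) else 0) * (μ₁ a * μ₂ s)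
        - y / (1 - y) * q * ∑ a ∈ Finset.range (M₁ + 1), ∑ s ∈ Finset.range (M₂ + 1),
            (if a + s ≤ k then (1 : ℝ) else 0) * (μ₁ a * μ₂ s)
        - y / (1 - y) * (1 - q) * ∑ a ∈ Finset.range (M₁ + 1), ∑ s ∈ Finset.range (M₂ + 1), μ₁ a * μ₂ s := by
    rw [Finset.mul_sum, Finset.mul_sum, Finset.mul_sum, ← Finset.sum_sub_distrib, ← Finset.sum_sub_distrib]
    refine Finset.sum_congr rfl fun a _ => ?_
    rw [Finset.mul_sum, Finset.mul_sum, Finset.mul_sum, ← Finset.sum_sub_distrib, ← Finset.sum_sub_distrib]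
    refine Finset.sum_congr rfl fun s _ => ?_
    push_cast
    ring
  rw [hL, hR, hmass, mul_one] at hsum
  linarith

/-- **the two-level certificate, cell by cell, for a row index at most both means** (`k ≤ T₁`, `k ≤ T₂`, `2k < q(T₁+T₂)`). [this work] -/
theorem belowMeans_cell {y q T₁ T₂ : ℝ} {k a s : ℕ} (hy0 : 0 < y) (hy1 : y < 1) (hyq : y ≤ q) (hq1 : q ≤ 1)
    (hk1 : (k : ℝ) ≤ T₁) (hk2 : (k : ℝ) ≤ T₂) (h2k : 2 * (k : ℝ) < q * (T₁ + T₂))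
    (ha : y * (a : ℝ) ≤ q * T₁) (hs : y * (s : ℝ) ≤ q * T₂) :
    (if s ≤ k then y / (1 - y) / (T₁ + T₂ - k) else y / (1 - y) / (T₁ + T₂)) * ((a : ℝ) - T₁)
      + (if a ≤ k then y / (1 - y) / (T₁ + T₂ - k) else y / (1 - y) / (T₁ + T₂)) * ((s : ℝ) - T₂)
    ≤ q * (if q * (T₁ + T₂) - k ≤ (a : ℝ) + s then 1 else 0) - y / (1 - y) * q * (if a + s ≤ k then 1 else 0)
        - y / (1 - y) * (1 - q) := by
  have h1y : 0 < 1 - y := by linarith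
  have hu : 0 < y / (1 - y) := div_pos hy0 h1y
  have hq0 : 0 < q := lt_of_lt_of_le hy0 hyq
  have hk : (0 : ℝ) ≤ k := Nat.cast_nonneg k
  have hT1 : 0 ≤ T₁ := le_trans hk hk1
  have hT2 : 0 ≤ T₂ := le_trans hk hk2
  have hkT1 : (k : ℝ) ≤ T₁ := hk1
  have hkT2 : (k : ℝ) ≤ T₂ := hk2
  have hT : 0 < T₁ + T₂ := by nlinarith
  have hTk : (k : ℝ) < T₁ + T₂ := by nlinarith
  have ha0 : (0 : ℝ) ≤ a := Nat.cast_nonneg a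
  have hs0 : (0 : ℝ) ≤ s := Nat.cast_nonneg s
  have hid : q * 1 - y / (1 - y) * q * 0 - y / (1 - y) * (1 - q) = y / (1 - y) * (q - y) / y := by
    field_simp
    ring
  have hqy : 0 ≤ y / (1 - y) * (q - y) / y := div_nonneg (mul_nonneg hu.le (by linarith)) hy0.le
  by_cases hsk : s ≤ k <;> by_cases hak : a ≤ k <;> simp only [hsk, hak, if_true, if_false]
  · -- region LL
    have hsk' : (s : ℝ) ≤ k := by exact_mod_cast hsk
    have hak' : (a : ℝ) ≤ k := by exact_mod_cast hak
    have e : y / (1 - y) / (T₁ + T₂ - ↑k) * (↑a - T₁) + y / (1 - y) / (T₁ + T₂ - ↑k) * (↑s - T₂)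
        = y / (1 - y) / (T₁ + T₂ - ↑k) * ((↑a + ↑s) - (T₁ + T₂)) := by ring
    rw [e]
    by_cases hlow : a + s ≤ k
    · have hlow' : (a : ℝ) + s ≤ k := by exact_mod_cast hlow
      have hnt : ¬ (q * (T₁ + T₂) - k ≤ (a : ℝ) + s) := by
        intro h; linarith
      rw [if_pos hlow, if_neg hnt]
      have := tilt_LL_low (T := T₁ + T₂) hu.le hTk hlow'
      linarith
    · rw [if_neg hlow]
      by_cases htg : q * (T₁ + T₂) - k ≤ (a : ℝ) + s
      · rw [if_pos htg, hid]
        have hD : 0 < T₁ + T₂ - k := by linarith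
        have hneg : y / (1 - y) / (T₁ + T₂ - ↑k) * ((↑a + ↑s) - (T₁ + T₂)) ≤ 0 := by
          have : 0 ≤ y / (1 - y) / (T₁ + T₂ - ↑k) * ((T₁ + T₂) - (↑a + ↑s)) :=
            mul_nonneg (div_pos hu hD).le (by nlinarith)
          linarith
        linarith
      · rw [if_neg htg]
        have hn : (a : ℝ) + s ≤ 2 * k := by linarith
        have := tilt_LL_mid (T := T₁ + T₂) (n := (a : ℝ) + s) hu.le hk hTk hq1 hn h2k
        linarith
  · -- region HL: s ≤ k < a
    have hak' : (k : ℝ) + 1 ≤ a := by exact_mod_cast Nat.lt_of_not_le hak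
    have hnl : ¬ (a + s ≤ k) := by omega
    rw [if_neg hnl]
    by_cases htg : q * (T₁ + T₂) - k ≤ (a : ℝ) + s
    · rw [if_pos htg, hid]
      have hsT : (s : ℝ) ≤ T₂ := le_trans (by exact_mod_cast hsk) hkT2
      have := tilt_LH_tgt (T₁ := T₂) (T₂ := T₁) (a := (s : ℝ)) (s := (a : ℝ)) hy0 hy1 hyq hk hsT hkT2 (by linarith) ha
      have e1 : T₂ + T₁ = T₁ + T₂ := add_comm _ _
      rw [e1] at this
      linarith
    · rw [if_neg htg]
      have hcell : (s : ℝ) + a ≤ q * (T₂ + T₁) - k := by linarith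
      have := tilt_LH_mid (T₁ := T₂) (T₂ := T₁) (a := (s : ℝ)) (s := (a : ℝ)) hu.le hk hs0 hT2 hT1 hq1 (by linarith) hcell
      have e1 : T₂ + T₁ = T₁ + T₂ := add_comm _ _
      rw [e1] at this
      linarith
  · -- region LH: a ≤ k < s
    have hsk' : (k : ℝ) + 1 ≤ s := by exact_mod_cast Nat.lt_of_not_le hsk
    have hnl : ¬ (a + s ≤ k) := by omega
    rw [if_neg hnl]
    by_cases htg : q * (T₁ + T₂) - k ≤ (a : ℝ) + s
    · rw [if_pos htg, hid]
      have haT : (a : ℝ) ≤ T₁ := le_trans (by exact_mod_cast hak) hkT1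
      have := tilt_LH_tgt hy0 hy1 hyq hk haT hkT1 hTk hs
      linarith
    · rw [if_neg htg]
      have hcell : (a : ℝ) + s ≤ q * (T₁ + T₂) - k := by linarith
      have := tilt_LH_mid hu.le hk ha0 hT1 hT2 hq1 hTk hcell
      linarith
  · -- region HH
    have hak' : (k : ℝ) + 1 ≤ a := by exact_mod_cast Nat.lt_of_not_le hak
    have hsk' : (k : ℝ) + 1 ≤ s := by exact_mod_cast Nat.lt_of_not_le hsk
    have hnl : ¬ (a + s ≤ k) := by omega
    rw [if_neg hnl]
    have e : y / (1 - y) / (T₁ + T₂) * (↑a - T₁) + y / (1 - y) / (T₁ + T₂) * (↑s - T₂)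
        = y / (1 - y) / (T₁ + T₂) * ((↑a + ↑s) - (T₁ + T₂)) := by ring
    rw [e]
    by_cases htg : q * (T₁ + T₂) - k ≤ (a : ℝ) + s
    · rw [if_pos htg, hid]
      have hn : y * ((a : ℝ) + s) ≤ q * (T₁ + T₂) := by linarith
      exact tilt_HH_tgt hy0 hy1 hT hn
    · rw [if_neg htg]
      have hn : (a : ℝ) + s ≤ q * (T₁ + T₂) - k := by linarith
      have := tilt_HH_mid (n := (a : ℝ) + s) hu.le hk hT hn
      linarith

/-- **EVERY ROW AT MOST BOTH MEANS IS FREE** (sharp form of `gateConv_row_belowTargets`: `k ≤ Tᵢ` instead of `k < q·Tᵢ`).  For a floor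
`0 < y < 1`, a gate `y ≤ q ≤ 1`, top-affordable probability laws `μ₁`, `μ₂` (means `T₁`, `T₂`, `y·Mᵢ ≤ q·Tᵢ`) and a row index `k` with
`k ≤ T₁`, `k ≤ T₂` and `2k < q(T₁+T₂)`: the two-layer row `d = k` of `gate (lconv M₁ M₂ μ₁ μ₂) q` at threshold `q(T₁+T₂)` holds,
with no hypothesis on the shape of the factors.  Consequently the conjectured closure `TLBGateConvClosedHeavy` is open only on the
rows `min(T₁,T₂) < k < q(T₁+T₂)/2`. [this work] -/
theorem gateConv_row_belowMeans {y q T₁ T₂ : ℝ} {M₁ M₂ k : ℕ} {μ₁ μ₂ : ℕ → ℝ}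
    (hy0 : 0 < y) (hy1 : y < 1) (hyq : y ≤ q) (hq1 : q ≤ 1)
    (h10 : ∀ h, 0 ≤ μ₁ h) (h11 : ∑ h ∈ Finset.range (M₁ + 1), μ₁ h = 1) (hT1 : ∑ h ∈ Finset.range (M₁ + 1), (h : ℝ) * μ₁ h = T₁)
    (h20 : ∀ h, 0 ≤ μ₂ h) (h21 : ∑ h ∈ Finset.range (M₂ + 1), μ₂ h = 1) (hT2 : ∑ h ∈ Finset.range (M₂ + 1), (h : ℝ) * μ₂ h = T₂)
    (hTA1 : y * (M₁ : ℝ) ≤ q * T₁) (hTA2 : y * (M₂ : ℝ) ≤ q * T₂)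
    (hk1 : (k : ℝ) ≤ T₁) (hk2 : (k : ℝ) ≤ T₂) (h2k : 2 * (k : ℝ) < q * (T₁ + T₂)) :
    y / (1 - y) * ∑ h ∈ Finset.range (k + 1), gate (lconv M₁ M₂ μ₁ μ₂) q h
      ≤ ∑ h ∈ Finset.range (M₁ + M₂ + 1),
          (if q * (T₁ + T₂) - k ≤ (h : ℝ) then gate (lconv M₁ M₂ μ₁ μ₂) q h else 0) := by
  have hkr : (0 : ℝ) ≤ k := Nat.cast_nonneg k
  have hT1M : T₁ ≤ M₁ := by rw [← hT1]; exact bm_mean_le M₁ μ₁ h10 h11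
  have hkM : k ≤ M₁ + M₂ := by
    have : (k : ℝ) ≤ M₁ := le_trans hk1 hT1M
    have : k ≤ M₁ := by exact_mod_cast this
    omega
  have hkt : (k : ℝ) < q * (T₁ + T₂) := by nlinarith
  refine bm_row_of_tilts
    (fun n => if n ≤ k then y / (1 - y) / (T₁ + T₂ - k) else y / (1 - y) / (T₁ + T₂))
    (fun n => if n ≤ k then y / (1 - y) / (T₁ + T₂ - k) else y / (1 - y) / (T₁ + T₂))
    hy0 hy1 h10 h11 hT1 h20 h21 hT2 hkM hkt ?_
  intro a s ha hs
  have haM : (a : ℝ) ≤ M₁ := by exact_mod_cast ha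
  have hsM : (s : ℝ) ≤ M₂ := by exact_mod_cast hs
  exact belowMeans_cell hy0 hy1 hyq hq1 hk1 hk2 h2k (by nlinarith) (by nlinarith)

end LawDec

end Quant

end Summit.CriticalPhenomena.PercolationContinuityZ3.Theorems
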